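import Summits.AtomisticToContinuum.FouriersLaw.Theorems.ContactStieltjesMeasureStieltjesRepresentationPencilCore
import Summits.AtomisticToContinuum.FouriersLaw.Theorems.ContactStieltjesMeasureStieltjesRepresentationPencilLink
import Summits.AtomisticToContinuum.FouriersLaw.Theorems.ContactStieltjesMeasureStieltjesRepresentationPencilAbstract

/-!
# Stub `stub_pencilOfGreenKubo` of line `cayley-pencil` (crux `ContactStieltjesMeasure.StieltjesRepresentation`,
# stmt-AtomisticToContinuum-15248): assembly

Helper file (`--supports stmt-AtomisticToContinuum-15248`) proving the registered stub `stub_pencilOfGreenKubo` of the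
`cayley-pencil` skeleton: for the pinned anharmonic chain (`ω₂ > 0`, `lam ≥ 0`, `β > 0`), `T > 0`, `N ≥ 2`, there are a real
Hilbert space `K`, a dissipative pencil `W γ` (`γ > 0`) on `K` — (R) `W γ - W γ' = (γ' - γ) W γ W γ'` and
(E) `⟪f, W γ f⟫ = γ ‖W γ f‖²` — and a vector `g` with `⟪g, W γ g⟫ = T⁻² ∫₀^∞ C_N(t; γ) dt` (boundary Green–Kubo integral).

Assembly of the parts landed before: Poisson SOLVERS `solF γ v`, `solB γ v` are chosen (by `Classical.choose`) from
`Pencil.exists_poisson_solution` for the adjoint fields of nice pairs (`Pencil.adjointField_nice`); `Pencil.exists_core_of_solvers`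
(part 6c) turns them into the core `(E, ι, Tm, Tm')` on `K = L²(μ_T) ⊕₂ L²(μ_T)` with (E₀), (E₀'), (A₀), (C₀);
`Pencil.exists_pencil_of_core` (part 1) extends the core to the pencil `W`; `g = ι(∂_{q_0}H/√T, 0)` (`Pencil.boundaryField_nice`),
and `Pencil.link_pairing` (part 6d) identifies `⟪g, W γ g⟫` with the Green–Kubo integral. No definitions, no new facts.
-/

noncomputable section

open MeasureTheory Filter Topology Set Function
open scoped ContDiff NNReal ENNReal
open Literature.MathematicalPhysics.KineticTheory.HeatConduction

namespace Summit.AtomisticToContinuum.FouriersLaw.Theorems.ContactStieltjesMeasure.CayleyPencil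

open Pencil in
/-- **Registered stub `stub_pencilOfGreenKubo` of line `cayley-pencil`** (exact registered signature): the dissipative pencil
`W` on a real Hilbert space `K` with the resolvent identity (R), the energy identity (E), and the Green–Kubo link
`⟪g, W γ g⟫ = T⁻² ∫₀^∞ C_N(t; γ) dt` for the pinned anharmonic chain at `lam ≥ 0`, `β > 0`.
[cite: LaxPhillips1967, Ch. II §3] [cite: CuneoEckmannHairerReyBellet2018, Thm 2.13] [cite: Carmona2007, Thm 2] -/
theorem stub_pencilOfGreenKubo :
    ∀ ω₂ lam β : ℝ, 0 < ω₂ → 0 ≤ lam → 0 < β → ∀ T : ℝ, 0 < T → ∀ (N : ℕ) (hN : 2 ≤ N),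
      ∃ (K : Type) (_ : NormedAddCommGroup K) (_ : InnerProductSpace ℝ K) (W : ℝ → K →L[ℝ] K) (g : K),
        (∀ γ γ' : ℝ, 0 < γ → 0 < γ' → ∀ f : K, W γ f - W γ' f = (γ' - γ) • W γ (W γ' f)) ∧
        (∀ γ : ℝ, 0 < γ → ∀ f : K, inner ℝ f (W γ f) = γ * ‖W γ f‖ ^ 2) ∧
        ∀ γ : ℝ, 0 < γ →
          IntegrableOn (fun t : ℝ =>
            (∫ z, (z.2 ⟨0, by omega⟩ * partialQ ⟨0, by omega⟩ ((pinnedChain ω₂ lam β γ).hamiltonian N) z) *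
                (∫ y, y.2 ⟨0, by omega⟩ * partialQ ⟨0, by omega⟩ ((pinnedChain ω₂ lam β γ).hamiltonian N) y
                  ∂((pinnedChain ω₂ lam β γ).transitionKernel N T T t.toNNReal z)) ∂((pinnedChain ω₂ lam β γ).gibbsMeasure N T)) -
              (∫ z, z.2 ⟨0, by omega⟩ * partialQ ⟨0, by omega⟩ ((pinnedChain ω₂ lam β γ).hamiltonian N) z ∂((pinnedChain ω₂ lam β γ).gibbsMeasure N T)) *
                (∫ z, z.2 ⟨0, by omega⟩ * partialQ ⟨0, by omega⟩ ((pinnedChain ω₂ lam β γ).hamiltonian N) z ∂((pinnedChain ω₂ lam β γ).gibbsMeasure N T))) (Set.Ioi 0) →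
            inner ℝ g (W γ g) = (∫ t in Set.Ioi (0 : ℝ), (fun t : ℝ =>
            (∫ z, (z.2 ⟨0, by omega⟩ * partialQ ⟨0, by omega⟩ ((pinnedChain ω₂ lam β γ).hamiltonian N) z) *
                (∫ y, y.2 ⟨0, by omega⟩ * partialQ ⟨0, by omega⟩ ((pinnedChain ω₂ lam β γ).hamiltonian N) y
                  ∂((pinnedChain ω₂ lam β γ).transitionKernel N T T t.toNNReal z)) ∂((pinnedChain ω₂ lam β γ).gibbsMeasure N T)) -
              (∫ z, z.2 ⟨0, by omega⟩ * partialQ ⟨0, by omega⟩ ((pinnedChain ω₂ lam β γ).hamiltonian N) z ∂((pinnedChain ω₂ lam β γ).gibbsMeasure N T)) *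
                (∫ z, z.2 ⟨0, by omega⟩ * partialQ ⟨0, by omega⟩ ((pinnedChain ω₂ lam β γ).hamiltonian N) z ∂((pinnedChain ω₂ lam β γ).gibbsMeasure N T))) t) / T ^ 2 := by
  intro ω₂ lam β hω hl hβ T hT N hN
  classical
  have hN0 : 0 < N := by omega
  -- the Poisson-solution package delivered by `exists_poisson_solution`, and solvers chosen from it
  let SolP : ℝ → (PhaseSpace N → ℝ) → (PhaseSpace N → ℝ) → Prop := fun γ v w =>
    ContDiff ℝ ∞ w ∧
      (∀ x, (pinnedChain ω₂ lam β γ).generator N T T w x = -v x) ∧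
      (∃ K' : ℝ, 0 ≤ K' ∧ ∀ x, |w x| ≤ K' * Real.exp ((pinnedChain ω₂ lam β γ).hamiltonian N x / (8 * T))) ∧
      (∃ M c : ℝ, 0 ≤ M ∧ 0 < c ∧ ∀ (t : ℝ≥0) (z : PhaseSpace N),
        |∫ y, v y ∂((pinnedChain ω₂ lam β γ).transitionKernel N T T t z)| ≤
          M * Real.exp ((pinnedChain ω₂ lam β γ).hamiltonian N z / (8 * T)) * Real.exp (-c * t)) ∧
      (fun x => ∫ t in Ioi (0 : ℝ), ∫ y, v y
        ∂((pinnedChain ω₂ lam β γ).transitionKernel N T T t.toNNReal x)) =ᵐ[volume] w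
  let solF : ℝ → (PhaseSpace N → ℝ) → PhaseSpace N → ℝ := fun γ v =>
    if h : ∃ w, SolP γ v w then Classical.choose h else 0
  let solB : ℝ → (PhaseSpace N → ℝ) → PhaseSpace N → ℝ := fun γ v => solF γ (fun x => v (x.1, -x.2))
  have hsol : ∀ (γ : ℝ) (v : PhaseSpace N → ℝ), (∃ w, SolP γ v w) → SolP γ v (solF γ v) := by
    intro γ v h
    have e : solF γ v = Classical.choose h := dif_pos h
    rw [e]
    exact Classical.choose_spec h
  -- the solvers on adjoint fields of nice pairs
  have hsolF : ∀ γ : ℝ, 0 < γ → ∀ (F₀ F₁ v : PhaseSpace N → ℝ), ContDiff ℝ ∞ F₀ → ContDiff ℝ ∞ F₁ → ∀ A : ℝ, 0 ≤ A →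
      (∀ y, |F₀ y| ≤ A * Real.exp ((pinnedChain ω₂ lam β γ).hamiltonian N y / (16 * T)) ∧
        |partialP ⟨0, by omega⟩ F₀ y| ≤ A * Real.exp ((pinnedChain ω₂ lam β γ).hamiltonian N y / (16 * T)) ∧
        |F₁ y| ≤ A * Real.exp ((pinnedChain ω₂ lam β γ).hamiltonian N y / (16 * T)) ∧
        |partialP ⟨N - 1, by omega⟩ F₁ y| ≤ A * Real.exp ((pinnedChain ω₂ lam β γ).hamiltonian N y / (16 * T))) →
      (∀ x, v x = Real.sqrt T * (-partialP ⟨0, by omega⟩ F₀ x + x.2 ⟨0, by omega⟩ * F₀ x / T) +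
        Real.sqrt T * (-partialP ⟨N - 1, by omega⟩ F₁ x + x.2 ⟨N - 1, by omega⟩ * F₁ x / T)) →
      ContDiff ℝ ∞ (solF γ v) ∧
        (∃ K : ℝ, ∀ y, |solF γ v y| ≤ K * Real.exp ((pinnedChain ω₂ lam β γ).hamiltonian N y / (8 * T))) ∧
        ∀ x, (pinnedChain ω₂ lam β γ).generator N T T (solF γ v) x = -v x := by
    intro γ hγ F₀ F₁ v hF₀ hF₁ A hA hb hv
    obtain ⟨hvs, -, ⟨C, hC, hvb, -⟩, hv0, -⟩ := adjointField_nice hω hl hβ.le hN hT γ hF₀ hF₁ hA hb hv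
    obtain ⟨hws, hLw, ⟨K, -, hwb⟩, -, -⟩ := hsol γ v (exists_poisson_solution hω hβ hγ hT hN0 hl hvs hC hvb hv0)
    exact ⟨hws, ⟨K, hwb⟩, hLw⟩
  have hsolB : ∀ γ : ℝ, 0 < γ → ∀ (F₀ F₁ v : PhaseSpace N → ℝ), ContDiff ℝ ∞ F₀ → ContDiff ℝ ∞ F₁ → ∀ A : ℝ, 0 ≤ A →
      (∀ y, |F₀ y| ≤ A * Real.exp ((pinnedChain ω₂ lam β γ).hamiltonian N y / (16 * T)) ∧
        |partialP ⟨0, by omega⟩ F₀ y| ≤ A * Real.exp ((pinnedChain ω₂ lam β γ).hamiltonian N y / (16 * T)) ∧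
        |F₁ y| ≤ A * Real.exp ((pinnedChain ω₂ lam β γ).hamiltonian N y / (16 * T)) ∧
        |partialP ⟨N - 1, by omega⟩ F₁ y| ≤ A * Real.exp ((pinnedChain ω₂ lam β γ).hamiltonian N y / (16 * T))) →
      (∀ x, v x = Real.sqrt T * (-partialP ⟨0, by omega⟩ F₀ x + x.2 ⟨0, by omega⟩ * F₀ x / T) +
        Real.sqrt T * (-partialP ⟨N - 1, by omega⟩ F₁ x + x.2 ⟨N - 1, by omega⟩ * F₁ x / T)) →
      ContDiff ℝ ∞ (solB γ v) ∧
        (∃ K : ℝ, ∀ y, |solB γ v y| ≤ K * Real.exp ((pinnedChain ω₂ lam β γ).hamiltonian N y / (8 * T))) ∧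
        ∀ x, (pinnedChain ω₂ lam β γ).generator N T T (solB γ v) x = -v (x.1, -x.2) := by
    intro γ hγ F₀ F₁ v hF₀ hF₁ A hA hb hv
    obtain ⟨-, hvs', ⟨C, hC, -, hvb'⟩, -, hv0'⟩ := adjointField_nice hω hl hβ.le hN hT γ hF₀ hF₁ hA hb hv
    obtain ⟨hws, hLw, ⟨K, -, hwb⟩, -, -⟩ :=
      hsol γ (fun x => v (x.1, -x.2)) (exists_poisson_solution hω hβ hγ hT hN0 hl hvs' hC hvb' hv0')
    exact ⟨hws, ⟨K, hwb⟩, hLw⟩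
  -- the core and its extension to the pencil
  obtain ⟨E, ι, Tm, Tm', hdense, hE, hE', hadj, hcross, hbook, hmemE⟩ :=
    exists_core_of_solvers hω hl hβ.le hN hT solF solB hsolF hsolB
  obtain ⟨W, hR, hEW, hWι⟩ := exists_pencil_of_core ι hdense Tm Tm' hE hE' hadj hcross
  -- the boundary vector `g = ι (∂_{q_0}H/√T, 0)`
  obtain ⟨hG₀s, -, hGb, hvG⟩ := boundaryField_nice (γ := (1 : ℝ)) hω hl hN hT hβ.le
  have hGmem := hmemE _ (fun _ => (0 : ℝ)) hG₀s contDiff_const hGb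
  let G : E := ⟨_, hGmem⟩
  -- the Green–Kubo link for the chosen forward solver
  have key : ∀ γ : ℝ, 0 < γ → ∀ v : PhaseSpace N → ℝ,
      (∀ x, v x = x.2 ⟨0, by omega⟩ * partialQ ⟨0, by omega⟩ ((pinnedChain ω₂ lam β γ).hamiltonian N) x / T) →
      (∫ x, (pinnedChain ω₂ lam β 1).gibbsDensity N T x)⁻¹ *
          ∫ x, solF γ v x * v x * (pinnedChain ω₂ lam β 1).gibbsDensity N T x =
        (∫ t in Set.Ioi (0 : ℝ),
          ((∫ z, (z.2 ⟨0, by omega⟩ * partialQ ⟨0, by omega⟩ ((pinnedChain ω₂ lam β γ).hamiltonian N) z) *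
                (∫ y, y.2 ⟨0, by omega⟩ * partialQ ⟨0, by omega⟩ ((pinnedChain ω₂ lam β γ).hamiltonian N) y
                  ∂((pinnedChain ω₂ lam β γ).transitionKernel N T T t.toNNReal z)) ∂((pinnedChain ω₂ lam β γ).gibbsMeasure N T)) -
              (∫ z, z.2 ⟨0, by omega⟩ * partialQ ⟨0, by omega⟩ ((pinnedChain ω₂ lam β γ).hamiltonian N) z ∂((pinnedChain ω₂ lam β γ).gibbsMeasure N T)) *
                (∫ z, z.2 ⟨0, by omega⟩ * partialQ ⟨0, by omega⟩ ((pinnedChain ω₂ lam β γ).hamiltonian N) z ∂((pinnedChain ω₂ lam β γ).gibbsMeasure N T)))) / T ^ 2 := by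
    intro γ hγ v hvx
    obtain rfl : v = fun x => x.2 ⟨0, by omega⟩ * partialQ ⟨0, by omega⟩ ((pinnedChain ω₂ lam β γ).hamiltonian N) x / T :=
      funext hvx
    -- data of the boundary field at friction `γ`, its Poisson solution, and the link
    obtain ⟨hG₀s', -, ⟨A, hA, hGb'⟩, hvG'⟩ := boundaryField_nice (γ := γ) hω hl hN hT hβ.le
    obtain ⟨hvs, -, ⟨C, hC, hvb, -⟩, hv0, -⟩ :=
      adjointField_nice hω hl hβ.le hN hT γ hG₀s' contDiff_const hA hGb' (fun x => (hvG' x).symm)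
    obtain ⟨-, -, -, ⟨M, c, -, hc, hdecay⟩, hae⟩ := hsol γ _ (exists_poisson_solution hω hβ hγ hT hN0 hl hvs hC hvb hv0)
    obtain ⟨-, hlink⟩ := link_pairing hω hl hβ hγ hN hT hc hdecay hae
    -- Gibbs-measure integrals are `Z⁻¹ ×` Gibbs-weighted Lebesgue integrals; the mean of `g₀` vanishes
    have hZf : ∀ f : PhaseSpace N → ℝ, ∫ z, f z ∂(pinnedChain ω₂ lam β γ).gibbsMeasure N T =
        (∫ x, (pinnedChain ω₂ lam β 1).gibbsDensity N T x)⁻¹ *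
          ∫ z, f z * (pinnedChain ω₂ lam β 1).gibbsDensity N T z :=
      fun f => (pinnedChain ω₂ lam β γ).integral_gibbsMeasure f
    have hT0 : T ≠ 0 := hT.ne'
    have hmean : ∫ z, z.2 ⟨0, by omega⟩ * partialQ ⟨0, by omega⟩ ((pinnedChain ω₂ lam β γ).hamiltonian N) z *
        (pinnedChain ω₂ lam β 1).gibbsDensity N T z = 0 := by
      have h0 : ∫ x, x.2 ⟨0, by omega⟩ * partialQ ⟨0, by omega⟩ ((pinnedChain ω₂ lam β γ).hamiltonian N) x / T *
          (pinnedChain ω₂ lam β 1).gibbsDensity N T x = 0 := hv0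
      have h1 : (fun z : PhaseSpace N => z.2 ⟨0, by omega⟩ *
          partialQ ⟨0, by omega⟩ ((pinnedChain ω₂ lam β γ).hamiltonian N) z * (pinnedChain ω₂ lam β 1).gibbsDensity N T z) =
          fun x => T * (x.2 ⟨0, by omega⟩ * partialQ ⟨0, by omega⟩ ((pinnedChain ω₂ lam β γ).hamiltonian N) x / T *
            (pinnedChain ω₂ lam β 1).gibbsDensity N T x) := by
        funext x
        field_simp
      rw [h1, integral_const_mul, h0, mul_zero]
    have hcorrT : ∀ t : ℝ, ((∫ z, (z.2 ⟨0, by omega⟩ * partialQ ⟨0, by omega⟩ ((pinnedChain ω₂ lam β γ).hamiltonian N) z) *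
                (∫ y, y.2 ⟨0, by omega⟩ * partialQ ⟨0, by omega⟩ ((pinnedChain ω₂ lam β γ).hamiltonian N) y
                  ∂((pinnedChain ω₂ lam β γ).transitionKernel N T T t.toNNReal z)) ∂((pinnedChain ω₂ lam β γ).gibbsMeasure N T)) -
              (∫ z, z.2 ⟨0, by omega⟩ * partialQ ⟨0, by omega⟩ ((pinnedChain ω₂ lam β γ).hamiltonian N) z ∂((pinnedChain ω₂ lam β γ).gibbsMeasure N T)) *
                (∫ z, z.2 ⟨0, by omega⟩ * partialQ ⟨0, by omega⟩ ((pinnedChain ω₂ lam β γ).hamiltonian N) z ∂((pinnedChain ω₂ lam β γ).gibbsMeasure N T))) =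
        (∫ x, (pinnedChain ω₂ lam β 1).gibbsDensity N T x)⁻¹ *
          (∫ z, (z.2 ⟨0, by omega⟩ * partialQ ⟨0, by omega⟩ ((pinnedChain ω₂ lam β γ).hamiltonian N) z) *
                (∫ y, y.2 ⟨0, by omega⟩ * partialQ ⟨0, by omega⟩ ((pinnedChain ω₂ lam β γ).hamiltonian N) y
                  ∂((pinnedChain ω₂ lam β γ).transitionKernel N T T t.toNNReal z)) * (pinnedChain ω₂ lam β 1).gibbsDensity N T z) := by
      intro t
      rw [hZf, hZf, hmean]
      simp only [mul_zero, sub_zero]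
    have hlink₁ : ∫ x, x.2 ⟨0, by omega⟩ * partialQ ⟨0, by omega⟩ ((pinnedChain ω₂ lam β γ).hamiltonian N) x / T *
          solF γ (fun x => x.2 ⟨0, by omega⟩ * partialQ ⟨0, by omega⟩ ((pinnedChain ω₂ lam β γ).hamiltonian N) x / T) x *
          (pinnedChain ω₂ lam β 1).gibbsDensity N T x =
        (T ^ 2)⁻¹ * ∫ t in Set.Ioi (0 : ℝ), (∫ z, (z.2 ⟨0, by omega⟩ * partialQ ⟨0, by omega⟩ ((pinnedChain ω₂ lam β γ).hamiltonian N) z) *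
                (∫ y, y.2 ⟨0, by omega⟩ * partialQ ⟨0, by omega⟩ ((pinnedChain ω₂ lam β γ).hamiltonian N) y
                  ∂((pinnedChain ω₂ lam β γ).transitionKernel N T T t.toNNReal z)) * (pinnedChain ω₂ lam β 1).gibbsDensity N T z) := hlink
    have hcomm : ∫ x, solF γ (fun x => x.2 ⟨0, by omega⟩ * partialQ ⟨0, by omega⟩ ((pinnedChain ω₂ lam β γ).hamiltonian N) x / T) x *
          (x.2 ⟨0, by omega⟩ * partialQ ⟨0, by omega⟩ ((pinnedChain ω₂ lam β γ).hamiltonian N) x / T) *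
          (pinnedChain ω₂ lam β 1).gibbsDensity N T x =
        ∫ x, x.2 ⟨0, by omega⟩ * partialQ ⟨0, by omega⟩ ((pinnedChain ω₂ lam β γ).hamiltonian N) x / T *
          solF γ (fun x => x.2 ⟨0, by omega⟩ * partialQ ⟨0, by omega⟩ ((pinnedChain ω₂ lam β γ).hamiltonian N) x / T) x *
          (pinnedChain ω₂ lam β 1).gibbsDensity N T x :=
      integral_congr_ae (Eventually.of_forall fun x => by ring)
    beta_reduce
    simp only [hcorrT]
    rw [integral_const_mul, hcomm, hlink₁]
    ring
  refine ⟨WithLp 2 (Lp ℝ 2 ((pinnedChain ω₂ lam β 1).gibbsMeasure N T) × Lp ℝ 2 ((pinnedChain ω₂ lam β 1).gibbsMeasure N T)),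
    inferInstance, inferInstance, W, ι G, hR, hEW, fun γ hγ _ => ?_⟩
  beta_reduce
  rw [hWι γ hγ G, hbook γ hγ G]
  exact key γ hγ _ (fun x => hvG x)

end Summit.AtomisticToContinuum.FouriersLaw.Theorems.ContactStieltjesMeasure.CayleyPencil

end
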